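import Summits.NavierStokesRegularity.NavierStokesRegularity.Theorems.CoriolisHeadTypeIRateHessianKernel
import Summits.NavierStokesRegularity.NavierStokesRegularity.Theorems.CoriolisHeadFarFieldLimitTools
import Literature.Analysis.FluidPDE.HarmonicBallMeanValue
import HarnessLib

/-!
# CoriolisHeadTypeIRateHessianWeight — crux `NoCoRotatingCore` (stmt-NavierStokesRegularity-22676), line
# `far_field_constancy` v2 (15c9a82ad206abb9), stub K1c: the weight `λ^{c,2c}` at large scales (pressure-Hessian rate, 2/4)

Generic potential theory on `ℝ³`, inputs for the upper end of the dyadic telescoping of the pressure Hessian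
(`CoriolisHeadTypeIRateHessianRate.lean`):
* §1 `norm_fderiv_newtonFarLaplacian_le`: `‖Dλ^{c,2c}(z)‖ ≤ M_λ/c⁴` by the tree scaling
  `λ^{c,2c}(z) = c⁻³λ^{1,2}(z/c)`; `fderiv_newtonFarLaplacian_eq_zero`: `Dλ^{c,2c} = 0` off the shell `c ≤ |z| ≤ 2c`.
* §2 `abs_shellMean_fderiv2_le_of_far`: if `‖∇P(w) − g‖ ≤ ε` for `‖w‖ ≥ R_g` then for `c ≥ max(1, R_g + ‖y‖)` the
  centred shell mean of a second derivative is small, `|∫ λ^{c,2c}(z) ∂ₑ∂_{e'}P(y+z) dz| ≤ 8 M_λ|B₁|‖e‖‖e'‖ε`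
  (integrate by parts onto `λ`, whose gradient is `O(c⁻⁴)` on a shell of volume `O(c³)`; the constant `⟪g, e'⟫`
  integrates to zero against `∂ₑλ`).
Everything is proved; no definitions.  WHAT THIS IS NOT: K1c, K1a, `NoCoRotatingCore` stay OPEN; nothing here
proves NS regularity.  References: Gilbarg–Trudinger (2001) §2.7, §4.2 [GilbargTrudinger2001].
-/

noncomputable section

open MeasureTheory Set Function Filter Topology Metric InnerProductSpace Real
open scoped RealInnerProductSpace Laplacian ContDiff

-- the summit and its single sub-problem share the name (CONVENTIONS §1), as in every Theorems file
set_option linter.dupNamespace false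
-- nested operator types
set_option maxSynthPendingDepth 3

namespace Summit.NavierStokesRegularity.NavierStokesRegularity.Theorems.CoriolisHead

namespace TypeIRate

open Literature.Analysis.FluidPDE

/-! ## §1 The weight `λ^{c,2c}`: gradient bound by scaling, support of the gradient -/

/-- `‖Dλ^{c,2c}(z)‖ ≤ M_λ/c⁴` where `M_λ = sup ‖Dλ^{1,2}‖` (`λ^{c,2c}(z) = c⁻³λ^{1,2}(z/c)`). [folklore] -/
theorem norm_fderiv_newtonFarLaplacian_le {M : ℝ}
    (hM : ∀ w : EuclideanSpace ℝ (Fin 3), ‖fderiv ℝ (newtonFarLaplacian 1 2) w‖ ≤ M) {c : ℝ} (hc : 0 < c)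
    (z : EuclideanSpace ℝ (Fin 3)) : ‖fderiv ℝ (newtonFarLaplacian c (2 * c)) z‖ ≤ M / c ^ 4 := by
  have hM0 : 0 ≤ M := (norm_nonneg _).trans (hM 0)
  have hfun : newtonFarLaplacian c (2 * c) =
      fun w : EuclideanSpace ℝ (Fin 3) => c⁻¹ ^ 3 * newtonFarLaplacian 1 2 (c⁻¹ • w) := by
    funext w
    have h := newtonFarLaplacian_scale hc 1 2 w
    rwa [mul_one, mul_comm c 2] at h
  have hd : Differentiable ℝ (newtonFarLaplacian 1 2 : EuclideanSpace ℝ (Fin 3) → ℝ) :=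
    (contDiff_newtonFarLaplacian one_pos one_lt_two (n := 1)).differentiable one_ne_zero
  have hder : HasFDerivAt (newtonFarLaplacian c (2 * c))
      (c⁻¹ ^ 3 • ((fderiv ℝ (newtonFarLaplacian 1 2) (c⁻¹ • z)).comp
        (c⁻¹ • ContinuousLinearMap.id ℝ (EuclideanSpace ℝ (Fin 3))))) z := by
    rw [hfun]
    have h1 : HasFDerivAt (fun w : EuclideanSpace ℝ (Fin 3) => c⁻¹ • w)
        (c⁻¹ • ContinuousLinearMap.id ℝ (EuclideanSpace ℝ (Fin 3))) z := (hasFDerivAt_id z).const_smul c⁻¹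
    have h2 : HasFDerivAt (fun w : EuclideanSpace ℝ (Fin 3) => newtonFarLaplacian 1 2 (c⁻¹ • w))
        ((fderiv ℝ (newtonFarLaplacian 1 2) (c⁻¹ • z)).comp
          (c⁻¹ • ContinuousLinearMap.id ℝ (EuclideanSpace ℝ (Fin 3)))) z :=
      (hd (c⁻¹ • z)).hasFDerivAt.comp z h1
    exact h2.const_mul (c⁻¹ ^ 3)
  rw [hder.fderiv, norm_smul, norm_pow, norm_inv, Real.norm_of_nonneg hc.le]
  calc c⁻¹ ^ 3 * ‖(fderiv ℝ (newtonFarLaplacian 1 2) (c⁻¹ • z)).comp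
        (c⁻¹ • ContinuousLinearMap.id ℝ (EuclideanSpace ℝ (Fin 3)))‖
      ≤ c⁻¹ ^ 3 * (M * c⁻¹) := by
        refine mul_le_mul_of_nonneg_left ?_ (by positivity)
        refine (ContinuousLinearMap.opNorm_comp_le _ _).trans ?_
        refine mul_le_mul (hM _) ?_ (norm_nonneg _) hM0
        rw [norm_smul, norm_inv, Real.norm_of_nonneg hc.le]
        exact mul_le_of_le_one_right (by positivity) ContinuousLinearMap.norm_id_le
    _ = M / c ^ 4 := by field_simp

/-- `Dλ^{c,2c}(z) = 0` off the closed shell `c ≤ ‖z‖ ≤ 2c`. [folklore] -/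
theorem fderiv_newtonFarLaplacian_eq_zero {c : ℝ} (hc : 0 < c) {z : EuclideanSpace ℝ (Fin 3)}
    (hz : ‖z‖ < c ∨ 2 * c < ‖z‖) : fderiv ℝ (newtonFarLaplacian c (2 * c)) z = 0 := by
  have h2c : c < 2 * c := by linarith
  have hev : newtonFarLaplacian c (2 * c) =ᶠ[𝓝 z] fun _ => (0 : ℝ) := by
    rcases hz with hz | hz
    · have hopen : IsOpen {w : EuclideanSpace ℝ (Fin 3) | ‖w‖ < c} := isOpen_lt continuous_norm continuous_const
      filter_upwards [hopen.mem_nhds hz] with w hw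
      exact newtonFarLaplacian_eq_zero_of_lt hc.le h2c hw
    · have hopen : IsOpen {w : EuclideanSpace ℝ (Fin 3) | 2 * c < ‖w‖} := isOpen_lt continuous_const continuous_norm
      filter_upwards [hopen.mem_nhds hz] with w hw
      exact newtonFarLaplacian_eq_zero_of_gt hc.le h2c hw
  rw [hev.fderiv_eq, fderiv_const_apply]

/-! ## §2 The far shells: the centred shell means of `∂ₑ∂_{e'}P` are small where `∇P ≈ g` -/

/-- **Upper limit of the telescoping.**  If `‖∇P(w) − g‖ ≤ ε` for `‖w‖ ≥ R_g`, then for `c ≥ 1` with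
`R_g + ‖y‖ ≤ c`: `|∫ λ^{c,2c}(z) ∂ₑ∂_{e'}P(y+z) dz| ≤ 8 M_λ |B₁| ‖e‖ ‖e'‖ ε` (integrate by parts onto `λ`,
whose gradient is `O(c⁻⁴)` on a shell of volume `O(c³)`). [folklore] -/
theorem abs_shellMean_fderiv2_le_of_far {M : ℝ}
    (hM : ∀ w : EuclideanSpace ℝ (Fin 3), ‖fderiv ℝ (newtonFarLaplacian 1 2) w‖ ≤ M)
    {P : EuclideanSpace ℝ (Fin 3) → ℝ} (hP : ContDiff ℝ ∞ P) {g : EuclideanSpace ℝ (Fin 3)} {ε Rg : ℝ}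
    (hε : 0 ≤ ε) (hRg : ∀ w : EuclideanSpace ℝ (Fin 3), Rg ≤ ‖w‖ → ‖gradient P w - g‖ ≤ ε)
    (y e e' : EuclideanSpace ℝ (Fin 3)) {c : ℝ} (hc1 : 1 ≤ c) (hcR : Rg + ‖y‖ ≤ c) :
    |∫ z, newtonFarLaplacian c (2 * c) z * fderiv ℝ (fun w => fderiv ℝ P w e') (y + z) e| ≤
      8 * M * (volume (ball (0 : EuclideanSpace ℝ (Fin 3)) 1)).toReal * ‖e‖ * ‖e'‖ * ε := by
  have hc : 0 < c := one_pos.trans_le hc1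
  have h2c : c < 2 * c := by linarith
  have hM0 : 0 ≤ M := (norm_nonneg _).trans (hM 0)
  set lam := newtonFarLaplacian c (2 * c) with hlam
  have hlam1 : ContDiff ℝ 1 lam := contDiff_newtonFarLaplacian hc h2c
  have hlamc : HasCompactSupport lam := hasCompactSupport_newtonFarLaplacian hc.le h2c
  -- `ψ(z) = ∂_{e'}P(y + z) − ⟪g, e'⟫`
  set ψ : EuclideanSpace ℝ (Fin 3) → ℝ := fun z => fderiv ℝ P (y + z) e' - ⟪g, e'⟫ with hψ
  have hPe' : ContDiff ℝ ∞ (fun w => fderiv ℝ P w e') := (hP.fderiv_right (m := ∞) le_rfl).clm_apply contDiff_const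
  have hψ1 : ContDiff ℝ 1 ψ :=
    ((hPe'.of_le (by norm_cast)).comp (contDiff_const.add contDiff_id)).sub contDiff_const
  have hψd : ∀ z, fderiv ℝ ψ z e = fderiv ℝ (fun w => fderiv ℝ P w e') (y + z) e := by
    intro z
    have h1 : HasFDerivAt (fun z : EuclideanSpace ℝ (Fin 3) => y + z)
        (ContinuousLinearMap.id ℝ (EuclideanSpace ℝ (Fin 3))) z := (hasFDerivAt_id z).const_add y
    have h2 : HasFDerivAt ψ
        ((fderiv ℝ (fun w => fderiv ℝ P w e') (y + z)).comp (ContinuousLinearMap.id ℝ (EuclideanSpace ℝ (Fin 3)))) z :=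
      (((hPe'.differentiable (by simp)) (y + z)).hasFDerivAt.comp z h1).sub_const _
    rw [h2.fderiv, ContinuousLinearMap.comp_id]
  -- integration by parts
  have hprod : ContDiff ℝ 1 fun z => lam z * ψ z := hlam1.mul hψ1
  have hzero := integral_fderiv_apply_eq_zero hprod hlamc.mul_right e
  have hderiv : ∀ z, fderiv ℝ (fun z => lam z * ψ z) z e = fderiv ℝ lam z e * ψ z + lam z * fderiv ℝ ψ z e := by
    intro z
    rw [fderiv_fun_mul ((hlam1.differentiable one_ne_zero) z) ((hψ1.differentiable one_ne_zero) z)]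
    simp only [FunLike.coe_add, FunLike.coe_smul, Pi.add_apply, Pi.smul_apply, smul_eq_mul]
    ring
  simp_rw [hderiv] at hzero
  have hi1 : Integrable fun z => fderiv ℝ lam z e * ψ z :=
    (((hlam1.continuous_fderiv one_ne_zero).clm_apply continuous_const).mul hψ1.continuous).integrable_of_hasCompactSupport
      ((hlamc.fderiv_apply (𝕜 := ℝ) e).mul_right)
  have hi2 : Integrable fun z => lam z * fderiv ℝ ψ z e :=
    (hlam1.continuous.mul ((hψ1.continuous_fderiv one_ne_zero).clm_apply continuous_const)).integrable_of_hasCompactSupport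
      hlamc.mul_right
  rw [integral_add hi1 hi2] at hzero
  have hrepr : (∫ z, lam z * fderiv ℝ (fun w => fderiv ℝ P w e') (y + z) e) = -∫ z, fderiv ℝ lam z e * ψ z := by
    have : (∫ z, lam z * fderiv ℝ (fun w => fderiv ℝ P w e') (y + z) e) = ∫ z, lam z * fderiv ℝ ψ z e := by
      refine integral_congr_ae (Eventually.of_forall fun z => ?_); simp only [hψd]
    rw [this]; linarith
  rw [hrepr, abs_neg]
  -- pointwise bound by a constant indicator
  set m : ℝ := M / c ^ 4 * ‖e‖ * (ε * ‖e'‖) with hm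
  have hm0 : 0 ≤ m := by positivity
  have hpt : ∀ z, ‖fderiv ℝ lam z e * ψ z‖ ≤
      (closedBall (0 : EuclideanSpace ℝ (Fin 3)) (2 * c)).indicator (fun _ => m) z := by
    intro z
    by_cases hz2 : 2 * c < ‖z‖
    · rw [hlam, fderiv_newtonFarLaplacian_eq_zero hc (Or.inr hz2)]
      simp only [_root_.zero_apply, zero_mul, norm_zero]
      exact Set.indicator_nonneg (fun _ _ => hm0) _
    rw [not_lt] at hz2
    rw [Set.indicator_of_mem (mem_closedBall_zero_iff.2 hz2)]
    by_cases hz1 : ‖z‖ < c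
    · rw [hlam, fderiv_newtonFarLaplacian_eq_zero hc (Or.inl hz1)]
      simp only [_root_.zero_apply, zero_mul, norm_zero]
      exact hm0
    rw [not_lt] at hz1
    have hyz : Rg ≤ ‖y + z‖ := by
      have h' : ‖z‖ ≤ ‖y + z‖ + ‖y‖ := by
        have := norm_sub_le (y + z) y; rwa [add_sub_cancel_left] at this
      linarith
    have hψz : ‖ψ z‖ ≤ ε * ‖e'‖ := by
      rw [hψ]
      simp only
      rw [show fderiv ℝ P (y + z) e' - ⟪g, e'⟫ = ⟪gradient P (y + z) - g, e'⟫ by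
        rw [inner_sub_left, Literature.Analysis.FluidPDE.inner_gradient_left], Real.norm_eq_abs]
      exact (abs_real_inner_le_norm _ _).trans (mul_le_mul_of_nonneg_right (hRg _ hyz) (norm_nonneg _))
    rw [norm_mul]
    calc ‖fderiv ℝ lam z e‖ * ‖ψ z‖ ≤ (M / c ^ 4 * ‖e‖) * (ε * ‖e'‖) := by
          refine mul_le_mul ?_ hψz (norm_nonneg _) (by positivity)
          exact (ContinuousLinearMap.le_opNorm _ _).trans
            (mul_le_mul_of_nonneg_right (norm_fderiv_newtonFarLaplacian_le hM hc z) (norm_nonneg _))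
      _ = m := by rw [hm]
  have hint : Integrable fun z => (closedBall (0 : EuclideanSpace ℝ (Fin 3)) (2 * c)).indicator (fun _ => m) z :=
    (integrableOn_const (measure_closedBall_lt_top.ne)).integrable_indicator measurableSet_closedBall
  calc |∫ z, fderiv ℝ lam z e * ψ z| = ‖∫ z, fderiv ℝ lam z e * ψ z‖ := (Real.norm_eq_abs _).symm
    _ ≤ ∫ z, (closedBall (0 : EuclideanSpace ℝ (Fin 3)) (2 * c)).indicator (fun _ => m) z :=
        norm_integral_le_of_norm_le hint (Eventually.of_forall hpt)
    _ = m * (volume (closedBall (0 : EuclideanSpace ℝ (Fin 3)) (2 * c))).toReal := by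
        rw [integral_indicator measurableSet_closedBall, setIntegral_const, smul_eq_mul, mul_comm]
        rfl
    _ = 8 * M * (volume (ball (0 : EuclideanSpace ℝ (Fin 3)) 1)).toReal * ‖e‖ * ‖e'‖ * ε / c := by
        rw [volumeReal_closedBall_eq (by positivity : (0 : ℝ) ≤ 2 * c), hm]
        field_simp
        ring
    _ ≤ 8 * M * (volume (ball (0 : EuclideanSpace ℝ (Fin 3)) 1)).toReal * ‖e‖ * ‖e'‖ * ε :=
        div_le_self (by positivity) hc1

end TypeIRate

end Summit.NavierStokesRegularity.NavierStokesRegularity.Theorems.CoriolisHead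

end
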